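import Summits.RiemannHypothesis.RiemannHypothesis.Theorems.SoninFrameAbstract
import Summits.RiemannHypothesis.RiemannHypothesis.Theorems.SemilocalSoninNearVector
import Summits.RiemannHypothesis.RiemannHypothesis.Theorems.SoninDistanceOne
import HarnessLib

/-!
# The frame criterion for the semilocal operator obligation (multi-vector certificates without orthonormalisation)

Cell `rh-explicit`, seat cc-s2-1 (HOME `run/shared/lean/pub/rh-explicit/`).  The tree's refutation criteria for the
obligation `SemilocalSoninIneqOn p a` (`not_semilocal_weakTrace_of_vector`, `not_semilocalSoninIneqOn_of_twisted_vector`,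
the bridges `not_semilocalSoninIneqOn_…_of_bdd_witness…`) use ONE Sonin vector.  The cell's numerics locate the failure
of the operator inequality at `S = {∞, 2}` through finite Sonin SECTIONS with several positive directions (COUNT 4–7
near `b ≈ 0.40–0.50`), where no single vector suffices.  This file is the multi-vector landing point:

* `scalingCoeff_add_right/_smul_right/_add_left/_smul_left` : sesquilinearity of CC's matrix coefficient
  `⟨ξ | ϑ(e^τ) η⟩` on `L²(ℝ)` (from `scalingCoeff_eq_inner`);
* `not_weakTrace_of_frame` : for ANY subspace `S ⊆ L²(ℝ)` and `k ∈ L¹`: a finite family `v_i ∈ S` with the frame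
  property `Σ_i |⟪v_i, x⟫|² ≤ ‖x‖²` and `Σ_i Re⟨v_i | ϑ(k) v_i⟩ > C` refutes the weak-trace bound with constant `C`
  over orthonormal families of `S` (Ky Fan relaxation, `SoninFrame.frame_sum_le_of_orthonormal_sum_le`, applied to the
  Hermitian symmetrisation of `(ξ, η) ↦ ∫ k(τ)⟨ξ | ϑ(e^τ) η⟩dτ`);
* `not_weakTrace_of_gershgorin` : the same with the frame property replaced by the Gershgorin row test on the Gram
  matrix, `Σ_j |⟪v_i, v_j⟫| ≤ 1`;
* `not_semilocalSoninIneqOn_of_frame` / `not_semilocalSoninIneqOn_of_twisted_frame` : the obligation itself, in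
  semilocal form (`v_i ∈ 𝔖_S(1,1)`) and in archimedean form (`v_i = θ_p ζ_i`, `ζ_i ∈ S(1,1)`, Gram entries by
  `inner_primeTwist_primeTwist`, diagonal terms `Re⟨ζ_i | ϑ(T_p k) ζ_i⟩`);
* `not_semilocalSoninIneqOn_of_near_frame` / `…_of_nearSonin_frame_one` : the certificate forms — the Sonin vectors
  `ζ_i` are replaced by EXPLICIT near-vectors `η_i` (even, vanishing on `[−1,1]`, band energies `ε_i`, distances
  `d_i² ≥ ε_i/(1 − 0.9999428)` by `SoninDistanceOne`), at the price of the Gershgorin slack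
  `4(d_i(N_j + d_j) + N_i d_j)` per Gram entry (`‖θ_p‖ ≤ 2`) and `K(2N_i + d_i)d_i` per diagonal term (`K ≥ ‖T_p k‖₁`).

Proof-only file (no definitions, no named facts); nothing here asserts that such families exist. [folklore]
-/

set_option linter.dupNamespace false  -- the mandated namespace repeats `RiemannHypothesis`

noncomputable section

open MeasureTheory Complex Set Finset FourierTransform
open scoped Real ComplexConjugate InnerProductSpace ENNReal

namespace Summit.RiemannHypothesis.RiemannHypothesis

open Literature.NumberTheory.LFunctions Literature.NumberTheory.ConnesConsani2021

/-! ## Sesquilinearity of the matrix coefficient `⟨ξ | ϑ(e^τ) η⟩` on `L²(ℝ)` -/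

section Sesq

/-- Additivity in the second slot. [folklore] -/
theorem scalingCoeff_add_right (ξ η ζ : Lp ℂ 2 (volume : Measure ℝ)) (τ : ℝ) :
    scalingCoeff ξ ((η + ζ : Lp ℂ 2 (volume : Measure ℝ)) : ℝ → ℂ) τ = scalingCoeff ξ η τ + scalingCoeff ξ ζ τ := by
  rw [scalingCoeff_eq_inner, scalingCoeff_eq_inner, scalingCoeff_eq_inner, map_add, inner_add_right]; ring

/-- Homogeneity in the second slot. [folklore] -/
theorem scalingCoeff_smul_right (c : ℂ) (ξ η : Lp ℂ 2 (volume : Measure ℝ)) (τ : ℝ) :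
    scalingCoeff ξ ((c • η : Lp ℂ 2 (volume : Measure ℝ)) : ℝ → ℂ) τ = c * scalingCoeff ξ η τ := by
  rw [scalingCoeff_eq_inner, scalingCoeff_eq_inner, map_smul, inner_smul_right]; ring

/-- Additivity in the first slot. [folklore] -/
theorem scalingCoeff_add_left (ξ ζ η : Lp ℂ 2 (volume : Measure ℝ)) (τ : ℝ) :
    scalingCoeff ((ξ + ζ : Lp ℂ 2 (volume : Measure ℝ)) : ℝ → ℂ) η τ = scalingCoeff ξ η τ + scalingCoeff ζ η τ := by
  rw [scalingCoeff_eq_inner, scalingCoeff_eq_inner, scalingCoeff_eq_inner, inner_add_left]; ring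

/-- Conjugate homogeneity in the first slot. [folklore] -/
theorem scalingCoeff_smul_left (c : ℂ) (ξ η : Lp ℂ 2 (volume : Measure ℝ)) (τ : ℝ) :
    scalingCoeff ((c • ξ : Lp ℂ 2 (volume : Measure ℝ)) : ℝ → ℂ) η τ = conj c * scalingCoeff ξ η τ := by
  rw [scalingCoeff_eq_inner, scalingCoeff_eq_inner, inner_smul_left]; ring

variable {k : ℝ → ℂ}

/-- `η ↦ ∫ k(τ)⟨ξ | ϑ(e^τ) η⟩dτ` is additive. [folklore] -/
theorem integral_mul_scalingCoeff_add_right (hk : Integrable k) (ξ η ζ : Lp ℂ 2 (volume : Measure ℝ)) :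
    ∫ τ, k τ * scalingCoeff ξ ((η + ζ : Lp ℂ 2 (volume : Measure ℝ)) : ℝ → ℂ) τ
      = (∫ τ, k τ * scalingCoeff ξ η τ) + ∫ τ, k τ * scalingCoeff ξ ζ τ := by
  rw [← integral_add (integrable_mul_scalingCoeff hk ξ η) (integrable_mul_scalingCoeff hk ξ ζ)]
  refine integral_congr_ae (Filter.Eventually.of_forall fun τ ↦ ?_)
  simp only [scalingCoeff_add_right]; ring

/-- `η ↦ ∫ k(τ)⟨ξ | ϑ(e^τ) η⟩dτ` is homogeneous. [folklore] -/
theorem integral_mul_scalingCoeff_smul_right (c : ℂ) (ξ η : Lp ℂ 2 (volume : Measure ℝ)) :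
    ∫ τ, k τ * scalingCoeff ξ ((c • η : Lp ℂ 2 (volume : Measure ℝ)) : ℝ → ℂ) τ
      = c * ∫ τ, k τ * scalingCoeff ξ η τ := by
  rw [← integral_const_mul]
  refine integral_congr_ae (Filter.Eventually.of_forall fun τ ↦ ?_)
  simp only [scalingCoeff_smul_right]; ring

/-- `ξ ↦ ∫ k(τ)⟨ξ | ϑ(e^τ) η⟩dτ` is additive. [folklore] -/
theorem integral_mul_scalingCoeff_add_left (hk : Integrable k) (ξ ζ η : Lp ℂ 2 (volume : Measure ℝ)) :
    ∫ τ, k τ * scalingCoeff ((ξ + ζ : Lp ℂ 2 (volume : Measure ℝ)) : ℝ → ℂ) η τ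
      = (∫ τ, k τ * scalingCoeff ξ η τ) + ∫ τ, k τ * scalingCoeff ζ η τ := by
  rw [← integral_add (integrable_mul_scalingCoeff hk ξ η) (integrable_mul_scalingCoeff hk ζ η)]
  refine integral_congr_ae (Filter.Eventually.of_forall fun τ ↦ ?_)
  simp only [scalingCoeff_add_left]; ring

/-- `ξ ↦ ∫ k(τ)⟨ξ | ϑ(e^τ) η⟩dτ` is conjugate-homogeneous. [folklore] -/
theorem integral_mul_scalingCoeff_smul_left (c : ℂ) (ξ η : Lp ℂ 2 (volume : Measure ℝ)) :
    ∫ τ, k τ * scalingCoeff ((c • ξ : Lp ℂ 2 (volume : Measure ℝ)) : ℝ → ℂ) η τ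
      = conj c * ∫ τ, k τ * scalingCoeff ξ η τ := by
  rw [← integral_const_mul]
  refine integral_congr_ae (Filter.Eventually.of_forall fun τ ↦ ?_)
  simp only [scalingCoeff_smul_left]; ring

end Sesq

/-! ## The frame criterion for weak-trace bounds on `L²(ℝ)` -/

section Frame

variable {k : ℝ → ℂ}

/-- **Frame criterion.**  Let `S ⊆ L²(ℝ)` be any subspace and `k ∈ L¹(ℝ)`.  If `v_1, …, v_m ∈ S` satisfy the frame
condition `Σ_i |⟪v_i, x⟫|² ≤ ‖x‖²` for every `x` and `Σ_i Re⟨v_i | ϑ(k) v_i⟩ > C`, then the weak-trace bound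
"`Σ_i Re⟨e_i | ϑ(k) e_i⟩ ≤ C` for every finite orthonormal family of `S`" fails.  (Ky Fan relaxation applied to the
Hermitian symmetrisation of `(ξ, η) ↦ ∫ k(τ)⟨ξ | ϑ(e^τ) η⟩dτ`; no orthonormalisation of the `v_i`.) [folklore] -/
theorem not_weakTrace_of_frame (hk : Integrable k) {S : Submodule ℂ (Lp ℂ 2 (volume : Measure ℝ))} {C : ℝ}
    {m : ℕ} {v : Fin m → Lp ℂ 2 (volume : Measure ℝ)} (hv : ∀ i, v i ∈ S)
    (hframe : ∀ x : Lp ℂ 2 (volume : Measure ℝ), ∑ i, ‖⟪v i, x⟫_ℂ‖ ^ 2 ≤ ‖x‖ ^ 2)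
    (hgt : C < ∑ i, (soninTraceForm k (v i : ℝ → ℂ)).re) :
    ¬ (∀ (n : ℕ) (ξ : Fin n → Lp ℂ 2 (volume : Measure ℝ)),
        Orthonormal ℂ ξ → (∀ i, ξ i ∈ S) → ∑ i, (soninTraceForm k (ξ i : ℝ → ℂ)).re ≤ C) := by
  intro h
  -- the Hermitian symmetrisation of `B(ξ, η) = ∫ k ⟨ξ|ϑ(e^τ)η⟩`
  set B : Lp ℂ 2 (volume : Measure ℝ) → Lp ℂ 2 (volume : Measure ℝ) → ℂ :=
    fun ξ η ↦ ∫ τ, k τ * scalingCoeff ξ η τ with hB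
  set s : Lp ℂ 2 (volume : Measure ℝ) → Lp ℂ 2 (volume : Measure ℝ) → ℂ :=
    fun ξ η ↦ (B ξ η + conj (B η ξ)) / 2 with hs
  have hs_add : ∀ x y z, s x (y + z) = s x y + s x z := fun x y z ↦ by
    simp only [hs, hB, integral_mul_scalingCoeff_add_right hk, integral_mul_scalingCoeff_add_left hk, map_add]
    ring
  have hs_smul : ∀ (c : ℂ) x y, s x (c • y) = c * s x y := fun c x y ↦ by
    simp only [hs, hB, integral_mul_scalingCoeff_smul_right, integral_mul_scalingCoeff_smul_left, map_mul,
      Complex.conj_conj]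
    ring
  have hs_symm : ∀ x y, s y x = conj (s x y) := fun x y ↦ by
    simp only [hs, map_add, Complex.conj_conj, map_div₀]
    rw [show conj (2 : ℂ) = 2 from Complex.conj_ofNat 2]  -- harmless if already normalised
    ring
  have hdiag : ∀ x, (s x x).re = (soninTraceForm k (x : ℝ → ℂ)).re := fun x ↦ by
    simp only [hs, hB]
    rw [show soninTraceForm k (x : ℝ → ℂ) = ∫ τ, k τ * scalingCoeff x x τ from rfl]
    rw [Complex.div_re, Complex.add_re, Complex.conj_re]
    norm_num
    ring
  have h' : ∀ (n : ℕ) (e : Fin n → Lp ℂ 2 (volume : Measure ℝ)), Orthonormal ℂ e → (∀ i, e i ∈ S) →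
      ∑ i, (s (e i) (e i)).re ≤ C := fun n e he hmem ↦ by
    simpa only [hdiag] using h n e he hmem
  have hle := SoninFrame.frame_sum_le_of_orthonormal_sum_le s hs_add hs_smul hs_symm h' hv hframe
  simp only [hdiag] at hle
  exact absurd hle (not_le.2 hgt)

/-- **Frame criterion, Gershgorin form**: the frame condition replaced by the row test `Σ_j |⟪v_i, v_j⟫| ≤ 1` on
the Gram matrix. [folklore] -/
theorem not_weakTrace_of_gershgorin (hk : Integrable k) {S : Submodule ℂ (Lp ℂ 2 (volume : Measure ℝ))}
    {C : ℝ} {m : ℕ} {v : Fin m → Lp ℂ 2 (volume : Measure ℝ)} (hv : ∀ i, v i ∈ S)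
    (hG : ∀ i, ∑ j, ‖⟪v i, v j⟫_ℂ‖ ≤ 1)
    (hgt : C < ∑ i, (soninTraceForm k (v i : ℝ → ℂ)).re) :
    ¬ (∀ (n : ℕ) (ξ : Fin n → Lp ℂ 2 (volume : Measure ℝ)),
        Orthonormal ℂ ξ → (∀ i, ξ i ∈ S) → ∑ i, (soninTraceForm k (ξ i : ℝ → ℂ)).re ≤ C) :=
  not_weakTrace_of_frame hk hv (SoninFrame.frame_of_gershgorin hG) hgt

end Frame

/-! ## The obligation `SemilocalSoninIneqOn p a` -/

section Obligation

variable (p : ℕ) [Fact p.Prime]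

/-- **Multi-vector refutation criterion for the obligation, semilocal form.**  A Weil test `g` on `[−a, a]` with CC's
two conditions, and a finite family `v_i ∈ 𝔖_S(1,1)` passing the Gershgorin row test with
`Σ_i Re⟨v_i | ϑ(k) v_i⟩ > Re(W_∞(k) − W_p(k))`, `k = g ⋆ g̃`, refute `SemilocalSoninIneqOn p a`. [folklore] -/
theorem not_semilocalSoninIneqOn_of_frame {a : ℝ} {g : ℝ → ℂ}
    (hg : IsWeilTest g) (hsupp : tsupport g ⊆ Icc (-a) a)
    (h1 : mulFourier g (I / 2) = 0) (h0 : mulFourier g 0 = 0)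
    {m : ℕ} {v : Fin m → Lp ℂ 2 (volume : Measure ℝ)} (hv : ∀ i, v i ∈ semilocalSoninSpace p 1 1)
    (hG : ∀ i, ∑ j, ‖⟪v i, v j⟫_ℂ‖ ≤ 1)
    (hgt : (archW (weilConv g (weilReflect g)) - weilSemilocalPrimeTerm {p} (weilConv g (weilReflect g))).re
            < ∑ i, (soninTraceForm (weilConv g (weilReflect g)) (v i : ℝ → ℂ)).re) :
    ¬ SemilocalSoninIneqOn p a := fun h =>
  not_weakTrace_of_gershgorin (integrable_weilConv_weilReflect hg) hv hG hgt (h g hg hsupp h1 h0)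

/-- **Multi-vector refutation criterion, archimedean (twisted) form.**  The same with `v_i = θ_p ζ_i`,
`ζ_i ∈ S(1,1)`: the Gram entries `⟪θ_pζ_i, θ_pζ_j⟫` are archimedean by `inner_primeTwist_primeTwist` and the diagonal
terms are `Re⟨ζ_i | ϑ(T_p k) ζ_i⟩` (`soninTraceForm_primeTwist`). [folklore] -/
theorem not_semilocalSoninIneqOn_of_twisted_frame {a : ℝ} {g : ℝ → ℂ}
    (hg : IsWeilTest g) (hsupp : tsupport g ⊆ Icc (-a) a)
    (h1 : mulFourier g (I / 2) = 0) (h0 : mulFourier g 0 = 0)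
    {m : ℕ} {ζ : Fin m → Lp ℂ 2 (volume : Measure ℝ)} (hζ : ∀ i, ζ i ∈ soninSpace 1 1)
    (hG : ∀ i, ∑ j, ‖⟪primeTwist p (ζ i), primeTwist p (ζ j)⟫_ℂ‖ ≤ 1)
    (hgt : (archW (weilConv g (weilReflect g)) - weilSemilocalPrimeTerm {p} (weilConv g (weilReflect g))).re
            < ∑ i, (soninTraceForm (twistKernel p (weilConv g (weilReflect g))) (ζ i : ℝ → ℂ)).re) :
    ¬ SemilocalSoninIneqOn p a := by
  refine not_semilocalSoninIneqOn_of_frame p hg hsupp h1 h0 (v := fun i ↦ primeTwist p (ζ i))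
    (fun i ↦ primeTwist_mem_semilocalSoninSpace p (hζ i)) hG ?_
  simpa only [soninTraceForm_primeTwist p (integrable_weilConv_weilReflect hg)] using hgt

end Obligation

/-! ## Certificate forms: explicit near-vectors -/

section NearFrame

variable (p : ℕ) [Fact p.Prime]

/-- **Gram perturbation under the twist**: `‖⟪θζ, θζ'⟫ − ⟪θη, θη'⟫‖ ≤ 4(‖ζ − η‖(‖η'‖ + ‖ζ' − η'‖) + ‖η‖‖ζ' − η'‖)`
(`‖θ_p‖ ≤ 2`). [folklore] -/
theorem norm_inner_primeTwist_sub_le (ζ η ζ' η' : Lp ℂ 2 (volume : Measure ℝ)) :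
    ‖⟪primeTwist p ζ, primeTwist p ζ'⟫_ℂ - ⟪primeTwist p η, primeTwist p η'⟫_ℂ‖
      ≤ 4 * (‖ζ - η‖ * (‖η'‖ + ‖ζ' - η'‖) + ‖η‖ * ‖ζ' - η'‖) := by
  have e : ⟪primeTwist p ζ, primeTwist p ζ'⟫_ℂ - ⟪primeTwist p η, primeTwist p η'⟫_ℂ
      = ⟪primeTwist p (ζ - η), primeTwist p ζ'⟫_ℂ + ⟪primeTwist p η, primeTwist p (ζ' - η')⟫_ℂ := by
    rw [map_sub, map_sub, inner_sub_left, inner_sub_right]; ring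
  rw [e]
  have h1 : ‖⟪primeTwist p (ζ - η), primeTwist p ζ'⟫_ℂ‖ ≤ 2 * ‖ζ - η‖ * (2 * (‖η'‖ + ‖ζ' - η'‖)) := by
    refine (norm_inner_le_norm _ _).trans (mul_le_mul (norm_primeTwist_le_two_mul p _) ?_ (norm_nonneg _)
      (by positivity))
    refine (norm_primeTwist_le_two_mul p _).trans ?_
    have : ‖ζ'‖ ≤ ‖η'‖ + ‖ζ' - η'‖ := by
      have := norm_add_le η' (ζ' - η'); rwa [add_sub_cancel] at this
    linarith
  have h2 : ‖⟪primeTwist p η, primeTwist p (ζ' - η')⟫_ℂ‖ ≤ 2 * ‖η‖ * (2 * ‖ζ' - η'‖) :=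
    (norm_inner_le_norm _ _).trans (mul_le_mul (norm_primeTwist_le_two_mul p _)
      (norm_primeTwist_le_two_mul p _) (norm_nonneg _) (by positivity))
  calc _ ≤ ‖⟪primeTwist p (ζ - η), primeTwist p ζ'⟫_ℂ‖ + ‖⟪primeTwist p η, primeTwist p (ζ' - η')⟫_ℂ‖ :=
        norm_add_le _ _
    _ ≤ 2 * ‖ζ - η‖ * (2 * (‖η'‖ + ‖ζ' - η'‖)) + 2 * ‖η‖ * (2 * ‖ζ' - η'‖) := add_le_add h1 h2
    _ = 4 * (‖ζ - η‖ * (‖η'‖ + ‖ζ' - η'‖) + ‖η‖ * ‖ζ' - η'‖) := by ring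

/-- **Multi-vector certificate with explicit near-vectors (smooth test function).**  Data: a Weil test `g` on
`[−a, a]` with CC's two conditions, `k = g ⋆ g̃`; Sonin vectors `ζ_i ∈ S(1,1)` within `d_i` of explicit `η_i`;
bounds `‖η_i‖ ≤ N_i`, `B_i ≤ Re⟨η_i | ϑ(T_p k) η_i⟩`, `|⟪θη_i, θη_j⟫| ≤ g_ij`, `‖T_p k‖₁ ≤ K`.  If every Gershgorin row
with slack is `≤ 1`, `Σ_j (g_ij + 4(d_i(N_j + d_j) + N_i d_j)) ≤ 1`, and
`Re(W_∞(k) − W_p(k)) < Σ_i (B_i − K(2N_i + d_i)d_i)`, the obligation `SemilocalSoninIneqOn p a` fails. [folklore] -/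
theorem not_semilocalSoninIneqOn_of_near_frame {a : ℝ} {g : ℝ → ℂ}
    (hg : IsWeilTest g) (hsupp : tsupport g ⊆ Icc (-a) a)
    (h1 : mulFourier g (I / 2) = 0) (h0 : mulFourier g 0 = 0)
    {m : ℕ} {η ζ : Fin m → Lp ℂ 2 (volume : Measure ℝ)} (hζ : ∀ i, ζ i ∈ soninSpace 1 1)
    {d N B : Fin m → ℝ} {Gb : Fin m → Fin m → ℝ} {K : ℝ}
    (hd : ∀ i, ‖η i - ζ i‖ ≤ d i) (hN : ∀ i, ‖η i‖ ≤ N i)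
    (hB : ∀ i, B i ≤ (soninTraceForm (twistKernel p (weilConv g (weilReflect g))) (η i : ℝ → ℂ)).re)
    (hGram : ∀ i j, ‖⟪primeTwist p (η i), primeTwist p (η j)⟫_ℂ‖ ≤ Gb i j)
    (hK : ∫ τ, ‖twistKernel p (weilConv g (weilReflect g)) τ‖ ≤ K)
    (hrow : ∀ i, ∑ j, (Gb i j + 4 * (d i * (N j + d j) + N i * d j)) ≤ 1)
    (hgt : (archW (weilConv g (weilReflect g)) - weilSemilocalPrimeTerm {p} (weilConv g (weilReflect g))).re
            < ∑ i, (B i - K * ((2 * N i + d i) * d i))) :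
    ¬ SemilocalSoninIneqOn p a := by
  set k := weilConv g (weilReflect g) with hk
  have hki : Integrable (twistKernel p k) := integrable_twistKernel p (integrable_weilConv_weilReflect hg)
  have hd' : ∀ i, ‖ζ i - η i‖ ≤ d i := fun i ↦ by rw [norm_sub_rev]; exact hd i
  have hd0 : ∀ i, 0 ≤ d i := fun i ↦ (norm_nonneg _).trans (hd i)
  have hN0 : ∀ i, 0 ≤ N i := fun i ↦ (norm_nonneg _).trans (hN i)
  have hζN : ∀ i, ‖ζ i‖ ≤ N i + d i := fun i ↦ by
    have := norm_add_le (η i) (ζ i - η i)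
    rw [add_sub_cancel] at this
    linarith [hN i, hd' i]
  refine not_semilocalSoninIneqOn_of_twisted_frame p hg hsupp h1 h0 hζ (fun i ↦ ?_) ?_
  · -- Gershgorin row with slack
    refine le_trans (Finset.sum_le_sum fun j _ ↦ ?_) (hrow i)
    have hpert := norm_inner_primeTwist_sub_le p (ζ i) (η i) (ζ j) (η j)
    have htri : ‖⟪primeTwist p (ζ i), primeTwist p (ζ j)⟫_ℂ‖
        ≤ ‖⟪primeTwist p (η i), primeTwist p (η j)⟫_ℂ‖
          + ‖⟪primeTwist p (ζ i), primeTwist p (ζ j)⟫_ℂ - ⟪primeTwist p (η i), primeTwist p (η j)⟫_ℂ‖ :=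
      norm_le_norm_add_norm_sub' _ _
    have a1 : ‖ζ i - η i‖ * (‖η j‖ + ‖ζ j - η j‖) ≤ d i * (N j + d j) :=
      mul_le_mul (hd' i) (add_le_add (hN j) (hd' j)) (by positivity) (hd0 i)
    have a2 : ‖η i‖ * ‖ζ j - η j‖ ≤ N i * d j := mul_le_mul (hN i) (hd' j) (norm_nonneg _) (hN0 i)
    linarith [hGram i j]
  · -- diagonal terms
    refine hgt.trans_le (Finset.sum_le_sum fun i _ ↦ ?_)
    have hv := norm_soninTraceForm_sub_vector_le hki (ζ i) (η i)
    have hre : (soninTraceForm (twistKernel p k) (η i : ℝ → ℂ)).re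
        - ‖soninTraceForm (twistKernel p k) (ζ i : ℝ → ℂ) - soninTraceForm (twistKernel p k) (η i : ℝ → ℂ)‖
        ≤ (soninTraceForm (twistKernel p k) (ζ i : ℝ → ℂ)).re := by
      have h := Complex.abs_re_le_norm
        (soninTraceForm (twistKernel p k) (ζ i : ℝ → ℂ) - soninTraceForm (twistKernel p k) (η i : ℝ → ℂ))
      rw [Complex.sub_re] at h
      have h' := (abs_le.mp h).1
      linarith
    have hK0 : 0 ≤ ∫ τ, ‖twistKernel p k τ‖ := integral_nonneg fun _ ↦ norm_nonneg _
    have hbound : (∫ τ, ‖twistKernel p k τ‖) * ((‖ζ i‖ + ‖η i‖) * ‖ζ i - η i‖) ≤ K * ((2 * N i + d i) * d i) := by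
      refine mul_le_mul hK ?_ (by positivity) (hK0.trans hK)
      exact mul_le_mul (by linarith [hζN i, hN i]) (hd' i) (norm_nonneg _) (by linarith [hN0 i, hd0 i])
    linarith [hB i]

/-- **Multi-vector certificate from band energies** (smooth test function): as `not_semilocalSoninIneqOn_of_near_frame`
with the Sonin vectors produced by the unconditional distance lemma (`SoninDistanceOne`): `η_i` a.e.-even and a.e.
zero on `[−1, 1]`, `∫_{[−1,1]}|𝓕η_i|² ≤ ε_i`, `ε_i/(1 − 9999428/10⁷) ≤ d_i²`, `0 ≤ d_i`. [folklore] -/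
theorem not_semilocalSoninIneqOn_of_nearSonin_frame_one {a : ℝ} {g : ℝ → ℂ}
    (hg : IsWeilTest g) (hsupp : tsupport g ⊆ Icc (-a) a)
    (h1 : mulFourier g (I / 2) = 0) (h0 : mulFourier g 0 = 0)
    {m : ℕ} {η : Fin m → Lp ℂ 2 (volume : Measure ℝ)} (hev : ∀ i, η i ∈ evenPart) (hvan : ∀ i, η i ∈ vanishOn 1)
    {ε d N B : Fin m → ℝ} {Gb : Fin m → Fin m → ℝ} {K : ℝ}
    (hε : ∀ i, ∫ x in Icc (-1 : ℝ) 1, ‖((𝓕 (η i) : Lp ℂ 2 (volume : Measure ℝ)) : ℝ → ℂ) x‖ ^ 2 ≤ ε i)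
    (hdε : ∀ i, ε i / (1 - 9999428 / 10000000) ≤ d i ^ 2) (hd0 : ∀ i, 0 ≤ d i) (hN : ∀ i, ‖η i‖ ≤ N i)
    (hB : ∀ i, B i ≤ (soninTraceForm (twistKernel p (weilConv g (weilReflect g))) (η i : ℝ → ℂ)).re)
    (hGram : ∀ i j, ‖⟪primeTwist p (η i), primeTwist p (η j)⟫_ℂ‖ ≤ Gb i j)
    (hK : ∫ τ, ‖twistKernel p (weilConv g (weilReflect g)) τ‖ ≤ K)
    (hrow : ∀ i, ∑ j, (Gb i j + 4 * (d i * (N j + d j) + N i * d j)) ≤ 1)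
    (hgt : (archW (weilConv g (weilReflect g)) - weilSemilocalPrimeTerm {p} (weilConv g (weilReflect g))).re
            < ∑ i, (B i - K * ((2 * N i + d i) * d i))) :
    ¬ SemilocalSoninIneqOn p a := by
  choose ζ hζ hest using fun i ↦ SoninDistance.exists_mem_soninSpace_one_one_norm_sub_sq_le (η i) (hev i) (hvan i)
  have hd : ∀ i, ‖η i - ζ i‖ ≤ d i := fun i ↦ by
    have hsq : ‖η i - ζ i‖ ^ 2 ≤ d i ^ 2 :=
      (hest i).trans ((div_le_div_of_nonneg_right (hε i) (by norm_num)).trans (hdε i))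
    exact (pow_le_pow_iff_left₀ (norm_nonneg _) (hd0 i) two_ne_zero).mp hsq
  exact not_semilocalSoninIneqOn_of_near_frame p hg hsupp h1 h0 hζ hd hN hB hGram hK hrow hgt

end NearFrame

end Summit.RiemannHypothesis.RiemannHypothesis

end
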